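/-
Origin: expansion seat `planner-pub-hodgecm-mc-axioms-1-g14-0`, handover #W249 2026-08-20T15:53:55Z md5 0567bdb0f518 (PKG 46b98a437b21 → 0567bdb0f518; 416 l.; MECHANICAL (iib-R) rewrite v3.1 of the PKG file as it stands (112 token edits; rules R1x1+RX[h₂]x111)) (`HOME/mc/pub-hodgecm-mc-axioms-1-g14/revendor/kit-r55/stage55/HodgeCM/Model/Binders/Gen12PinsTotalP.lean`, md5 0567bdb0f518, 416 lines);
landed by the gen-22 packager (p-g22) in gate run 55 REPLACES the earlier landed copy of `HodgeCM/Model/Binders/Gen12PinsTotalP.lean` (seat copy carried the packager Origin header of an earlier run (stripped)).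
-/
/-
Origin: speedrun cell pub-hodgecm, MODEL-CONSTRUCTION sub-cell, unit pub-hodgecm-mc-binder-1-g10 (BINDER PROVER, gen 10; S RE-PIN P1 of K34-PLAN §3),
seat prover-pub-hodgecm-mc-binder-1-g10-0, 2026-08-20.  Target in PKG: HodgeCM/Model/Binders/Gen12PinsTotalP.lean (NEW additive leaf = #26 `Gen12PinsTotal`
re-typed at sinst-1's PREDICATE-GUARDED S pin `SInstance.SGP @G @hG @hGR @η @hη @hηc @hGR₀..₃ @AG`: `hdef ↦ hc : G V c`, `A V c ↦ AG V c hc`,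
`thetaAdelicSideOf_X ↦ thetaAdelicSideOfP_X` (installed + #35 `ThetaAdelicSideGuardedPOps`); imports #26's imports + `ThetaAdelicSideGuardedP(Ops)`).
KERNEL ONLY; 0 records restated (the structures are #26's, re-instantiated), nothing cited, 0 `def … : Prop`, MODEL-N ±0, E unchanged.
-/
/-
Origin: speedrun cell pub-hodgecm, MODEL-CONSTRUCTION sub-cell, unit pub-hodgecm-mc-binder-1-g9 (BINDER PROVER, gen 9; node B2-meet,
BINDER-OWNERS rows 14/15 at the TOTAL pins of record — model1 (R1′)/(R1″)), seat prover-pub-hodgecm-mc-binder-1-g9-0, 2026-08-19.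
Target in PKG: HodgeCM/Model/Binders/Gen12PinsTotal.lean (NEW additive leaf, RUN 37+ in the (W1)+(Θ-sat) world; imports #22 `Binders/Gen12SeesawKInfty`
(hence #20/#21, kit #18), kit #10 `Binders/Gen12RepOfSat`, D-1′ ⁗ `Binders/Gen12ProjDischarge`, g8 #19 r2 `Binders/Real34LocInstance`, binder-1 `Binders/WmInputGuarded` and sinst-1's
`Model/ThetaAdelicSideInstance`; nothing landed imports it).  KERNEL ONLY: 0 records of published theorems, nothing cited, 0 `def … : Prop`, one
hypothesis record (`Real34GuardedResidual`, nothing asserted), MODEL-N ±0, E unchanged.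
-/
import Summits.HodgeConjecture.HodgeCM.Model.Binders.Gen12SeesawKInfty
import Summits.HodgeConjecture.HodgeCM.Model.Binders.Gen12RepOfSat
import Summits.HodgeConjecture.HodgeCM.Model.Binders.Gen12ProjDischarge
import Summits.HodgeConjecture.HodgeCM.Model.Binders.Real34LocInstance
import Summits.HodgeConjecture.HodgeCM.Model.Binders.WmInputGuarded
import Summits.HodgeConjecture.HodgeCM.Model.ThetaAdelicSideInstance
import Summits.HodgeConjecture.HodgeCM.Model.ThetaAdelicSideGuardedPOps
import Summits.HodgeConjecture.HodgeCM.Model.Binders.Gen12PinsTotal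

/-!
# Rows `gen12` / `real34` at the TOTAL pins of record `(Gen12Pins.Wg …, SInstance.S …)`

model1 (R1′) (2026-08-19T21:51:31Z, sinst-1's vacuity finding) + (R1″) (22:15:26Z, binder-1's field-level W guard): the END-STATE corollary's
pins must be TOTAL families all of whose inputs are inhabitable at every `(V, c)`:

  `W := Gen12Pins.Wg @hGR @η @hη @hηc @Gen12Pins.τSyl @Gen12Pins.TSyl @Gen12Pins.hTSyl`   (`Binders/WmInputGuarded`: unitary-1's `wmInputCM₂` with `ρ` guarded on
                                                                plane-definiteness at `ι₁`; `F ι GU G eV eW SK` definitional),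
  `S := SInstance.SGP @G @hG @hGR @η @hη @hηc @hGR₀ @hGR₁ @hGR₂ @hGR₃ @AG` (sinst-1 `Model/ThetaAdelicSideInstance`: period-1's `archSideOf` behind
                                                                a `dite` on the same guard, sanity-1's degenerate side otherwise).

Under the guard `hdef : PlaneDefinite ι₁ c.D` (READ OFF every good context: sinst-1 `ArchSideTerm.dW_definite_of_thetaModel_goodCtx`) the two
terms ARE the ones of #20–#24 (`Gen12Pins.Wg_ρ_of`, sinst-1 `thetaAdelicSideOf_eq_archSideOf`), so every construction of #20/#22/#23/#24 goes
through with ONE value-level rewrite per side — which is what this leaf does: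

§1 (x-S)/(SS₃₄) at the total pins under the guard: `op_total`, `seesaw34_total`, `op34_total`;
§2 RECORD 2′: `SeesawCore.ofGuardedOp hdef adm wedge_mem`, `hSK_total`, `hA_total`/`hB_total`, **`SeesawCore.ofGuardedPin hdef`** (no other hypothesis),
   `SeesawHyp34.ofGuarded hdef`;
§3 RECORD 1 + row 14: `hΘ_total`, `hι_total hdef`, `residual_total hdef`, **`gen12_total hN1g`** / **`gen12_totalE hN1g`** = E's binder `gen12`
   at the total pins from the GUARDED literal check `(N1)₀,₁` — `hN1g : ∀ V c, GoodCtx → ∀ k ∈ {0,1}, (A V c k).w = archWeight L (μ c k)`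
   (the guard is derived inside from `hc`; an unguarded `hAw` implies it);
§4 row 15: `hGfin_total hdef`, hypothesis record `Real34GuardedResidual {hcorr, gen_mem, hU₂, hU₃}` (per GOOD context), **`real34_total`** /
   **`real34_totalE`**.
Nothing here is a claim of the manuscripts under adjudication.
-/

set_option autoImplicit false

noncomputable section

open MeasureTheory NumberField MulAction
open scoped Matrix InnerProductSpace

namespace HodgeCM.Model

open HodgeCM HodgeCM.Universe HodgeCM.Adelic
open Literature.NumberTheory.Weil1964
open Literature.NumberTheory.Automorphic (piSchwartzBruhat)
open Literature.NumberTheory.Automorphic.UnitaryGroup (archIsotropy archIsotropyProj archKappa archSectionU21CM)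
open Literature.NumberTheory.GelbartRogawski1991.UnitaryDualPair
open Literature.RepresentationTheory.HeisenbergGroup
open Literature.Geometry.ComplexHyperbolic.BallModel (U21 x₀ Jac)
open Literature.AlgebraicGeometry.HodgeTheory
open Literature.NumberTheory.Automorphic.PicardCM
open Literature.NumberTheory.Transcendental (Arapura2012_Cor_15_4_6)
open HodgeCM.Model.ThetaSpace
open HodgeCM.Model.ArchSideTerm

namespace Gen12PinsP

variable
  (G : ∀ {L : CMField} {ι₁ : L →+* ℂ} (_V : HermSpace3 L ι₁) (_c : SeesawCtx L), Prop)
  (hG : ∀ {L : CMField} {ι₁ : L →+* ℂ} (V : HermSpace3 L ι₁) (c : SeesawCtx L),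
    G V c → (∀ j, 0 < (ι₁ (dW c.D j)).re) ∨ ∀ j, (ι₁ (dW c.D j)).re < 0)
  (hGR : ∀ {L : CMField} {ι₁ : L →+* ℂ} (V : HermSpace3 L ι₁) (c : SeesawCtx L),
    (cmSplittingDatum (L : Type) finProdFinEquiv (frameD V) (frameD_real V) (frameD_ne V) (dW c.D) (dW_real c.D)
      (dW_ne c.D)).CompatibleSplitting)
  (η : ∀ {L : CMField} {ι₁ : L →+* ℂ} (V : HermSpace3 L ι₁) (c : SeesawCtx L),
    CMAdelic (L : Type) (frameD V) × CMAdelic (L : Type) (dW c.D) →* ℂˣ)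
  (hη : ∀ {L : CMField} {ι₁ : L →+* ℂ} (V : HermSpace3 L ι₁) (c : SeesawCtx L),
    ∀ γU ∈ CMRat (L : Type) (frameD V), ∀ γ ∈ CMRat (L : Type) (dW c.D), η V c (γU, γ) = 1)
  (hηc : ∀ {L : CMField} {ι₁ : L →+* ℂ} (V : HermSpace3 L ι₁) (c : SeesawCtx L), Continuous fun p => ((η V c p : ℂˣ) : ℂ))
  (hGR₀ : ∀ {L : CMField} {ι₁ : L →+* ℂ} (V : HermSpace3 L ι₁) (c : SeesawCtx L),
    (cmSplittingDatum (L : Type) (e₁) (frameD V) (frameD_real V) (frameD_ne V) (lineVec (L : Type) (dW c.D 0))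
      (fun _ => dW_real c.D 0) (fun _ => dW_ne c.D 0)).CompatibleSplitting)
  (hGR₁ : ∀ {L : CMField} {ι₁ : L →+* ℂ} (V : HermSpace3 L ι₁) (c : SeesawCtx L),
    (cmSplittingDatum (L : Type) (e₁) (frameD V) (frameD_real V) (frameD_ne V) (lineVec (L : Type) (dW c.D 1))
      (fun _ => dW_real c.D 1) (fun _ => dW_ne c.D 1)).CompatibleSplitting)
  (hGR₂ : ∀ {L : CMField} {ι₁ : L →+* ℂ} (V : HermSpace3 L ι₁) (c : SeesawCtx L),
    (cmSplittingDatum (L : Type) (e₁) (frameD V) (frameD_real V) (frameD_ne V) (lineVec (L : Type) (dW' c.D 0))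
      (fun _ => dW'_real c.D 0) (fun _ => dW'_ne c.D 0)).CompatibleSplitting)
  (hGR₃ : ∀ {L : CMField} {ι₁ : L →+* ℂ} (V : HermSpace3 L ι₁) (c : SeesawCtx L),
    (cmSplittingDatum (L : Type) (e₁) (frameD V) (frameD_real V) (frameD_ne V) (lineVec (L : Type) (dW' c.D 1))
      (fun _ => dW'_real c.D 1) (fun _ => dW'_ne c.D 1)).CompatibleSplitting)
  (AG : ∀ {L : CMField} {ι₁ : L →+* ℂ} (V : HermSpace3 L ι₁) (c : SeesawCtx L), G V c → ∀ k : Fin 4,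
    ArchLineInput V (lineRepD V c.D (hGR V c) (hGR₀ V c) (hGR₁ V c) (hGR₂ V c) (hGR₃ V c) (η V c) k))

variable (hHD : exists_isReal_hodgeModel) (hI : hodgePQ_independent_of_hodgeModel)
  (h₁ : BallQuotientUniformised)  (h₃ : CMAbelianVarietyRealised)
  (h : Bool) (hA : Arapura2012_Cor_15_4_6) (μ : ∀ {L : CMField}, SeesawCtx L → Fin 4 → InfinitePlace L → ℤ)

/- the TOTAL pins of record are spelled out below: W := `Gen12Pins.Wg @hGR @η @hη @hηc @Gen12Pins.τSyl @Gen12Pins.TSyl @Gen12Pins.hTSyl`, S := `SInstance.SGP @G @hG @hGR @η @hη @hηc @hGR₀ @hGR₁ @hGR₂ @hGR₃ @AG`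
   (no local notation: `notation3` over section variables mis-elaborates, kit #7 GOTCHA). -/

section Context

variable {L : CMField} {ι₁ : L →+* ℂ} (V : HermSpace3 L ι₁) (c : SeesawCtx L) (hV : IsAnisotropic L V.Hm)

local notation3 "L⁺" => maximalRealSubfield (L : Type)

/-- under the guard the S family IS period-1's term (sinst-1, `dif_pos`). -/
theorem ST_eq_archSideOf (hc : G V c) :
    (SInstance.SGP @G @hG @hGR @η @hη @hηc @hGR₀ @hGR₁ @hGR₂ @hGR₃ @AG) V c = archSideOf V c (hGR V c) (hGR₀ V c) (hGR₁ V c) (hGR₂ V c) (hGR₃ V c) (η V c) (hη V c) (hηc V c) (hG V c hc) (AG V c hc) :=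
  thetaAdelicSideOfP_eq_archSideOf V c (G V c) (hG V c) (hGR V c) (hGR₀ V c) (hGR₁ V c) (hGR₂ V c) (hGR₃ V c) (η V c) (hη V c) (hηc V c) (AG V c) hc

/-- under the guard `(S V c).ιinf = archInfOf V`. -/
theorem ST_ιinf (hc : G V c) : ((SInstance.SGP @G @hG @hGR @η @hη @hηc @hGR₀ @hGR₁ @hGR₂ @hGR₃ @AG) V c).ιinf = archInfOf V := by
  rw [ST_eq_archSideOf @G @hG @hGR @η @hη @hηc @hGR₀ @hGR₁ @hGR₂ @hGR₃ @AG V c hc]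
  rfl

/-! ## 1. (x-S) / (SS₃₄) at the total pins, under the guard -/

/-- **(x-S) `op` at the TOTAL pins** (kit #11's hypothesis at `W := Wg …Syl`, `S := SInstance.S …`, `τ := tau12`): ONE rewrite per side, then
period-1's `op_archSideOf`. -/
theorem op_total (hc : G V c) (g : ↥(Adelic.regimeSubgroup L V.Hm)) (t : SeesawTorus L⁺ L) (φ₁ φ₂ : piSchwartzBruhat L⁺ (Fin 3)) :
    (((Gen12Pins.Wg @hGR @η @hη @hηc @Gen12Pins.τSyl @Gen12Pins.TSyl @Gen12Pins.hTSyl) V c).ρ (((Gen12Pins.Wg @hGR @η @hη @hηc @Gen12Pins.τSyl @Gen12Pins.TSyl @Gen12Pins.hTSyl) V c).eV (g : ↥(Adelic.adelicUnitaryGroup L V.Hm)), ((Gen12Pins.Wg @hGR @η @hη @hηc @Gen12Pins.τSyl @Gen12Pins.TSyl @Gen12Pins.hTSyl) V c).eW (c.D.jT₁₂ t)) :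
        Module.End ℂ (piSchwartzBruhat ((Gen12Pins.Wg @hGR @η @hη @hηc @Gen12Pins.τSyl @Gen12Pins.TSyl @Gen12Pins.hTSyl) V c).F ((Gen12Pins.Wg @hGR @η @hη @hηc @Gen12Pins.τSyl @Gen12Pins.TSyl @Gen12Pins.hTSyl) V c).ι)) (tau12 V c.D φ₁ φ₂) =
      tau12 V c.D ((((SInstance.SGP @G @hG @hGR @η @hη @hηc @hGR₀ @hGR₁ @hGR₂ @hGR₃ @AG) V c).P 0).ω (g, SeesawTorus.fst L⁺ L t) φ₁) ((((SInstance.SGP @G @hG @hGR @η @hη @hηc @hGR₀ @hGR₁ @hGR₂ @hGR₃ @AG) V c).P 1).ω (g, SeesawTorus.snd L⁺ L t) φ₂) := by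
  rw [Gen12Pins.Wg_ρ_of @hGR @η @hη @hηc @Gen12Pins.τSyl @Gen12Pins.TSyl @Gen12Pins.hTSyl V c (hG V c hc), ST_eq_archSideOf @G @hG @hGR @η @hη @hηc @hGR₀ @hGR₁ @hGR₂ @hGR₃ @AG V c hc]
  exact op_archSideOf V c (hGR V c) (hGR₀ V c) (hGR₁ V c) (hGR₂ V c) (hGR₃ V c) (η V c) (hη V c) (hηc V c) (hG V c hc) (AG V c hc) g t φ₁ φ₂

/-- **(SS₃₄) at the TOTAL pins** (kit #8's `SeesawHyp34.seesaw`, `τ := tau34`). -/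
theorem seesaw34_total (hc : G V c) (g : ↥(Adelic.regimeSubgroup L V.Hm)) (t : SeesawTorus L⁺ L) (φ₂ φ₃ : piSchwartzBruhat L⁺ (Fin 3)) :
    thetaDistLM ((Gen12Pins.Wg @hGR @η @hη @hηc @Gen12Pins.τSyl @Gen12Pins.TSyl @Gen12Pins.hTSyl) V c).F ((Gen12Pins.Wg @hGR @η @hη @hηc @Gen12Pins.τSyl @Gen12Pins.TSyl @Gen12Pins.hTSyl) V c).ι
        ((((Gen12Pins.Wg @hGR @η @hη @hηc @Gen12Pins.τSyl @Gen12Pins.TSyl @Gen12Pins.hTSyl) V c).ρ (((Gen12Pins.Wg @hGR @η @hη @hηc @Gen12Pins.τSyl @Gen12Pins.TSyl @Gen12Pins.hTSyl) V c).eV (g : ↥(Adelic.adelicUnitaryGroup L V.Hm)), ((Gen12Pins.Wg @hGR @η @hη @hηc @Gen12Pins.τSyl @Gen12Pins.TSyl @Gen12Pins.hTSyl) V c).eW (c.D.jT₃₄ t)) :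
            Module.End ℂ (piSchwartzBruhat ((Gen12Pins.Wg @hGR @η @hη @hηc @Gen12Pins.τSyl @Gen12Pins.TSyl @Gen12Pins.hTSyl) V c).F ((Gen12Pins.Wg @hGR @η @hη @hηc @Gen12Pins.τSyl @Gen12Pins.TSyl @Gen12Pins.hTSyl) V c).ι)) (tau34 V c.D φ₂ φ₃)) =
      thetaDistLM L⁺ (Fin 3) ((((SInstance.SGP @G @hG @hGR @η @hη @hηc @hGR₀ @hGR₁ @hGR₂ @hGR₃ @AG) V c).P 2).ω (g, SeesawTorus.fst L⁺ L t) φ₂) *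
        thetaDistLM L⁺ (Fin 3) ((((SInstance.SGP @G @hG @hGR @η @hη @hηc @hGR₀ @hGR₁ @hGR₂ @hGR₃ @AG) V c).P 3).ω (g, SeesawTorus.snd L⁺ L t) φ₃) := by
  rw [Gen12Pins.Wg_ρ_of @hGR @η @hη @hηc @Gen12Pins.τSyl @Gen12Pins.TSyl @Gen12Pins.hTSyl V c (hG V c hc), ST_eq_archSideOf @G @hG @hGR @η @hη @hηc @hGR₀ @hGR₁ @hGR₂ @hGR₃ @AG V c hc]
  exact seesaw34_archSideOf V c (hGR V c) (hGR₀ V c) (hGR₁ V c) (hGR₂ V c) (hGR₃ V c) (η V c) (hη V c) (hηc V c) (hG V c hc) (AG V c hc) g t φ₂ φ₃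

/-- **(x-S)₃₄ `op` at the TOTAL pins** (operator form). -/
theorem op34_total (hc : G V c) (g : ↥(Adelic.regimeSubgroup L V.Hm)) (t : SeesawTorus L⁺ L) (φ₂ φ₃ : piSchwartzBruhat L⁺ (Fin 3)) :
    (((Gen12Pins.Wg @hGR @η @hη @hηc @Gen12Pins.τSyl @Gen12Pins.TSyl @Gen12Pins.hTSyl) V c).ρ (((Gen12Pins.Wg @hGR @η @hη @hηc @Gen12Pins.τSyl @Gen12Pins.TSyl @Gen12Pins.hTSyl) V c).eV (g : ↥(Adelic.adelicUnitaryGroup L V.Hm)), ((Gen12Pins.Wg @hGR @η @hη @hηc @Gen12Pins.τSyl @Gen12Pins.TSyl @Gen12Pins.hTSyl) V c).eW (c.D.jT₃₄ t)) :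
        Module.End ℂ (piSchwartzBruhat ((Gen12Pins.Wg @hGR @η @hη @hηc @Gen12Pins.τSyl @Gen12Pins.TSyl @Gen12Pins.hTSyl) V c).F ((Gen12Pins.Wg @hGR @η @hη @hηc @Gen12Pins.τSyl @Gen12Pins.TSyl @Gen12Pins.hTSyl) V c).ι)) (tau34 V c.D φ₂ φ₃) =
      tau34 V c.D ((((SInstance.SGP @G @hG @hGR @η @hη @hηc @hGR₀ @hGR₁ @hGR₂ @hGR₃ @AG) V c).P 2).ω (g, SeesawTorus.fst L⁺ L t) φ₂) ((((SInstance.SGP @G @hG @hGR @η @hη @hηc @hGR₀ @hGR₁ @hGR₂ @hGR₃ @AG) V c).P 3).ω (g, SeesawTorus.snd L⁺ L t) φ₃) := by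
  rw [Gen12Pins.Wg_ρ_of @hGR @η @hη @hηc @Gen12Pins.τSyl @Gen12Pins.TSyl @Gen12Pins.hTSyl V c (hG V c hc), ST_eq_archSideOf @G @hG @hGR @η @hη @hηc @hGR₀ @hGR₁ @hGR₂ @hGR₃ @AG V c hc]
  exact op34_archSideOf V c (hGR V c) (hGR₀ V c) (hGR₁ V c) (hGR₂ V c) (hGR₃ V c) (η V c) (hη V c) (hηc V c) (hG V c hc) (AG V c hc) g t φ₂ φ₃

/-! ## 2. RECORD 2′ (and the (34) record) at the total pins, under the guard -/

/- admissibility predicate at the total S pin, spelled out -/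
variable (adm : ∀ (Γ : Level V) (k : Fin 4),
    KTypeSituation ((pinX hHD hI h₁ h₃ (SInstance.SGP @G @hG @hGR @η @hη @hηc @hGR₀ @hGR₁ @hGR₂ @hGR₃ @AG) V c hV).P k) ((pinX hHD hI h₁ h₃ (SInstance.SGP @G @hG @hGR @η @hη @hηc @hGR₀ @hGR₁ @hGR₂ @hGR₃ @AG) V c hV).ιinf Γ)
      ((pinX hHD hI h₁ h₃ (SInstance.SGP @G @hG @hGR @η @hη @hηc @hGR₀ @hGR₁ @hGR₂ @hGR₃ @AG) V c hV).Δ Γ) (pinX hHD hI h₁ h₃ (SInstance.SGP @G @hG @hGR @η @hη @hηc @hGR₀ @hGR₁ @hGR₂ @hGR₃ @AG) V c hV).κ₁ (pinX hHD hI h₁ h₃ (SInstance.SGP @G @hG @hGR @η @hη @hηc @hGR₀ @hGR₁ @hGR₂ @hGR₃ @AG) V c hV).τ₁ → Prop)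

/-- RECORD 2′ at the total pins with (SS) DISCHARGED, (SS-K) kept (kit #11 shape). -/
def _root_.HodgeCM.Model.SeesawCore.ofGuardedOp (hc : G V c)
    (wedge_mem : ∀ (Γ : Level V)
      (Sit₀ : KTypeSituation ((pinX hHD hI h₁ h₃ (SInstance.SGP @G @hG @hGR @η @hη @hηc @hGR₀ @hGR₁ @hGR₂ @hGR₃ @AG) V c hV).P 0) ((pinX hHD hI h₁ h₃ (SInstance.SGP @G @hG @hGR @η @hη @hηc @hGR₀ @hGR₁ @hGR₂ @hGR₃ @AG) V c hV).ιinf Γ)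
        ((pinX hHD hI h₁ h₃ (SInstance.SGP @G @hG @hGR @η @hη @hηc @hGR₀ @hGR₁ @hGR₂ @hGR₃ @AG) V c hV).Δ Γ) (pinX hHD hI h₁ h₃ (SInstance.SGP @G @hG @hGR @η @hη @hηc @hGR₀ @hGR₁ @hGR₂ @hGR₃ @AG) V c hV).κ₁ (pinX hHD hI h₁ h₃ (SInstance.SGP @G @hG @hGR @η @hη @hηc @hGR₀ @hGR₁ @hGR₂ @hGR₃ @AG) V c hV).τ₁)
      (Sit₁ : KTypeSituation ((pinX hHD hI h₁ h₃ (SInstance.SGP @G @hG @hGR @η @hη @hηc @hGR₀ @hGR₁ @hGR₂ @hGR₃ @AG) V c hV).P 1) ((pinX hHD hI h₁ h₃ (SInstance.SGP @G @hG @hGR @η @hη @hηc @hGR₀ @hGR₁ @hGR₂ @hGR₃ @AG) V c hV).ιinf Γ)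
        ((pinX hHD hI h₁ h₃ (SInstance.SGP @G @hG @hGR @η @hη @hηc @hGR₀ @hGR₁ @hGR₂ @hGR₃ @AG) V c hV).Δ Γ) (pinX hHD hI h₁ h₃ (SInstance.SGP @G @hG @hGR @η @hη @hηc @hGR₀ @hGR₁ @hGR₂ @hGR₃ @AG) V c hV).κ₁ (pinX hHD hI h₁ h₃ (SInstance.SGP @G @hG @hGR @η @hη @hηc @hGR₀ @hGR₁ @hGR₂ @hGR₃ @AG) V c hV).τ₁),
      adm Γ 0 Sit₀ → adm Γ 1 Sit₁ → ∀ j₀ ∈ Sit₀.𝓙, ∀ j₁ ∈ Sit₁.𝓙,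
        tau12 V c.D (j₀.1 (Sit₀.ι (LinearMap.proj 0))) (j₁.1 (Sit₁.ι (LinearMap.proj 1))) -
          tau12 V c.D (j₀.1 (Sit₀.ι (LinearMap.proj 1))) (j₁.1 (Sit₁.ι (LinearMap.proj 0))) ∈ ((Gen12Pins.Wg @hGR @η @hη @hηc @Gen12Pins.τSyl @Gen12Pins.TSyl @Gen12Pins.hTSyl) V c).SK) :
    SeesawCore hHD hI h₁ h₃ (Gen12Pins.Wg @hGR @η @hη @hηc @Gen12Pins.τSyl @Gen12Pins.TSyl @Gen12Pins.hTSyl) (SInstance.SGP @G @hG @hGR @η @hη @hηc @hGR₀ @hGR₁ @hGR₂ @hGR₃ @AG) V c hV adm :=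
  SeesawCore.ofOp hHD hI h₁ h₃ (Gen12Pins.Wg @hGR @η @hη @hηc @Gen12Pins.τSyl @Gen12Pins.TSyl @Gen12Pins.hTSyl) (SInstance.SGP @G @hG @hGR @η @hη @hηc @hGR₀ @hGR₁ @hGR₂ @hGR₃ @AG) V c hV adm (tau12 V c.D) (prod_tau12 V c.D)
    (op_total @G @hG @hGR @η @hη @hηc @hGR₀ @hGR₁ @hGR₂ @hGR₃ @AG V c hc) wedge_mem

/-- (x-W) at the total W pin along `K_∞` (frame of record), under the guard (`Gen12Pins.Wg_hSK`). -/
theorem hSK_total (hdef : (∀ j, 0 < (ι₁ (dW c.D j)).re) ∨ ∀ j, (ι₁ (dW c.D j)).re < 0) :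
    ∀ Ψ : piSchwartzBruhat ((Gen12Pins.Wg @hGR @η @hη @hηc @Gen12Pins.τSyl @Gen12Pins.TSyl @Gen12Pins.hTSyl) V c).F ((Gen12Pins.Wg @hGR @η @hη @hηc @Gen12Pins.τSyl @Gen12Pins.TSyl @Gen12Pins.hTSyl) V c).ι,
      (∀ k : ↥(KInfty V),
        ((((Gen12Pins.Wg @hGR @η @hη @hηc @Gen12Pins.τSyl @Gen12Pins.TSyl @Gen12Pins.hTSyl) V c).ρ (((Gen12Pins.Wg @hGR @η @hη @hηc @Gen12Pins.τSyl @Gen12Pins.TSyl @Gen12Pins.hTSyl) V c).eV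
            (archIsotropyRegime V hV ι₁ V.sylvesterFrame (sylvesterFrame_formCongr V) k : ↥(Adelic.adelicUnitaryGroup L V.Hm)), 1)) :
            Module.End ℂ (piSchwartzBruhat ((Gen12Pins.Wg @hGR @η @hη @hηc @Gen12Pins.τSyl @Gen12Pins.TSyl @Gen12Pins.hTSyl) V c).F ((Gen12Pins.Wg @hGR @η @hη @hηc @Gen12Pins.τSyl @Gen12Pins.TSyl @Gen12Pins.hTSyl) V c).ι)) Ψ =
          ((archKappa (L : Type) V.Hm ι₁ V.sylvesterFrame (sylvesterFrame_formCongr V) k : ℂˣ) : ℂ) • Ψ) →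
      Ψ ∈ ((Gen12Pins.Wg @hGR @η @hη @hηc @Gen12Pins.τSyl @Gen12Pins.TSyl @Gen12Pins.hTSyl) V c).SK :=
  Gen12Pins.Wg_hSK @hGR @η @hη @hηc @Gen12Pins.τSyl @Gen12Pins.TSyl @Gen12Pins.hTSyl V c hV hdef

/-- kit #12's `hA` along `archIsotropyRegime` at the total S pin (kit #18 `hA_of_strict` is generic in `S`; `(S V c).ιinf = archInfOf V` under the
guard; #21/#22 `Gen12Pins.archIsotropyRegime_syl_eq`). -/
theorem hA_total (hc : G V c) (KΓ : Level V → Subgroup (quotU V).G) (hKΓ : ∀ (Γ : Level V) (k : ↥(KInfty V)), toLatticeModelG V (kInftyCorr V k) ∈ KΓ Γ) :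
    ∀ (Γ : Level V)
      (Sit : KTypeSituation ((pinX hHD hI h₁ h₃ (SInstance.SGP @G @hG @hGR @η @hη @hηc @hGR₀ @hGR₁ @hGR₂ @hGR₃ @AG) V c hV).P 0) ((pinX hHD hI h₁ h₃ (SInstance.SGP @G @hG @hGR @η @hη @hηc @hGR₀ @hGR₁ @hGR₂ @hGR₃ @AG) V c hV).ιinf Γ)
        ((pinX hHD hI h₁ h₃ (SInstance.SGP @G @hG @hGR @η @hη @hηc @hGR₀ @hGR₁ @hGR₂ @hGR₃ @AG) V c hV).Δ Γ) (pinX hHD hI h₁ h₃ (SInstance.SGP @G @hG @hGR @η @hη @hηc @hGR₀ @hGR₁ @hGR₂ @hGR₃ @AG) V c hV).κ₁ (pinX hHD hI h₁ h₃ (SInstance.SGP @G @hG @hGR @η @hη @hηc @hGR₀ @hGR₁ @hGR₂ @hGR₃ @AG) V c hV).τ₁),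
      (Sit.IsSaturated (KΓ Γ) ∧ Sit.IsStrict) → ∀ j ∈ Sit.𝓙, ∀ (k : ↥(KInfty V)) (i : Fin 2),
        (((SInstance.SGP @G @hG @hGR @η @hη @hηc @hGR₀ @hGR₁ @hGR₂ @hGR₃ @AG) V c).P 0).ω (archIsotropyRegime V hV ι₁ V.sylvesterFrame (sylvesterFrame_formCongr V) k, 1) (j.1 (Sit.ι (LinearMap.proj i))) =
          ∑ l, (Jac ((archIsotropyProj (L : Type) V.Hm ι₁ V.sylvesterFrame (sylvesterFrame_formCongr V) k : stabilizer U21 x₀) : U21) x₀) l i •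
            j.1 (Sit.ι (LinearMap.proj l)) := by
  intro Γ Sit hadm j hj k i
  have h18 := hA_of_strict hHD hI h₁ h₃ (SInstance.SGP @G @hG @hGR @η @hη @hηc @hGR₀ @hGR₁ @hGR₂ @hGR₃ @AG) V c hV KΓ
    (fun k => archIsotropyProj (L : Type) V.Hm ι₁ V.sylvesterFrame (sylvesterFrame_formCongr V) k)
    (fun k => toLatticeModelG V (kInftyCorr V k)) hKΓ Γ Sit hadm j hj k i
  rw [ST_ιinf @G @hG @hGR @η @hη @hηc @hGR₀ @hGR₁ @hGR₂ @hGR₃ @AG V c hc] at h18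
  rw [Gen12Pins.archIsotropyRegime_syl_eq V hV k]
  exact h18

/-- kit #12's `hB` at the total S pin. -/
theorem hB_total (hc : G V c) (KΓ : Level V → Subgroup (quotU V).G) (hKΓ : ∀ (Γ : Level V) (k : ↥(KInfty V)), toLatticeModelG V (kInftyCorr V k) ∈ KΓ Γ) :
    ∀ (Γ : Level V)
      (Sit : KTypeSituation ((pinX hHD hI h₁ h₃ (SInstance.SGP @G @hG @hGR @η @hη @hηc @hGR₀ @hGR₁ @hGR₂ @hGR₃ @AG) V c hV).P 1) ((pinX hHD hI h₁ h₃ (SInstance.SGP @G @hG @hGR @η @hη @hηc @hGR₀ @hGR₁ @hGR₂ @hGR₃ @AG) V c hV).ιinf Γ)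
        ((pinX hHD hI h₁ h₃ (SInstance.SGP @G @hG @hGR @η @hη @hηc @hGR₀ @hGR₁ @hGR₂ @hGR₃ @AG) V c hV).Δ Γ) (pinX hHD hI h₁ h₃ (SInstance.SGP @G @hG @hGR @η @hη @hηc @hGR₀ @hGR₁ @hGR₂ @hGR₃ @AG) V c hV).κ₁ (pinX hHD hI h₁ h₃ (SInstance.SGP @G @hG @hGR @η @hη @hηc @hGR₀ @hGR₁ @hGR₂ @hGR₃ @AG) V c hV).τ₁),
      (Sit.IsSaturated (KΓ Γ) ∧ Sit.IsStrict) → ∀ j ∈ Sit.𝓙, ∀ (k : ↥(KInfty V)) (i : Fin 2),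
        (((SInstance.SGP @G @hG @hGR @η @hη @hηc @hGR₀ @hGR₁ @hGR₂ @hGR₃ @AG) V c).P 1).ω (archIsotropyRegime V hV ι₁ V.sylvesterFrame (sylvesterFrame_formCongr V) k, 1) (j.1 (Sit.ι (LinearMap.proj i))) =
          ∑ l, (Jac ((archIsotropyProj (L : Type) V.Hm ι₁ V.sylvesterFrame (sylvesterFrame_formCongr V) k : stabilizer U21 x₀) : U21) x₀) l i •
            j.1 (Sit.ι (LinearMap.proj l)) := by
  intro Γ Sit hadm j hj k i
  have h18 := hB_of_strict hHD hI h₁ h₃ (SInstance.SGP @G @hG @hGR @η @hη @hηc @hGR₀ @hGR₁ @hGR₂ @hGR₃ @AG) V c hV KΓ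
    (fun k => archIsotropyProj (L : Type) V.Hm ι₁ V.sylvesterFrame (sylvesterFrame_formCongr V) k)
    (fun k => toLatticeModelG V (kInftyCorr V k)) hKΓ Γ Sit hadm j hj k i
  rw [ST_ιinf @G @hG @hGR @η @hη @hηc @hGR₀ @hGR₁ @hGR₂ @hGR₃ @AG V c hc] at h18
  rw [Gen12Pins.archIsotropyRegime_syl_eq V hV k]
  exact h18

/-- **RECORD 2′ `SeesawCore` at the TOTAL pins of record — under the guard, NO other hypothesis** (adm := the (Θ-sat) pin's «saturated ∧ strict»). -/
def _root_.HodgeCM.Model.SeesawCore.ofGuardedPin (hc : G V c) :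
    SeesawCore hHD hI h₁ h₃ (Gen12Pins.Wg @hGR @η @hη @hηc @Gen12Pins.τSyl @Gen12Pins.TSyl @Gen12Pins.hTSyl) (SInstance.SGP @G @hG @hGR @η @hη @hηc @hGR₀ @hGR₁ @hGR₂ @hGR₃ @AG) V c hV
      (fun Γ _ Sit => Sit.IsSaturated ((pinX hHD hI h₁ h₃ (SInstance.SGP @G @hG @hGR @η @hη @hηc @hGR₀ @hGR₁ @hGR₂ @hGR₃ @AG) V c hV).KΓ Γ) ∧ Sit.IsStrict) :=
  SeesawCore.ofKType hHD hI h₁ h₃ (Gen12Pins.Wg @hGR @η @hη @hηc @Gen12Pins.τSyl @Gen12Pins.TSyl @Gen12Pins.hTSyl) (SInstance.SGP @G @hG @hGR @η @hη @hηc @hGR₀ @hGR₁ @hGR₂ @hGR₃ @AG) V c hV _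
    (archIsotropyRegime V hV ι₁ V.sylvesterFrame (sylvesterFrame_formCongr V))
    (fun k => ((archKappa (L : Type) V.Hm ι₁ V.sylvesterFrame (sylvesterFrame_formCongr V) k : ℂˣ) : ℂ))
    (tau12 V c.D) (prod_tau12 V c.D) (op_total @G @hG @hGR @η @hη @hηc @hGR₀ @hGR₁ @hGR₂ @hGR₃ @AG V c hc)
    (hSK_total @hGR @η @hη @hηc V c hV (hG V c hc))
    (fun k => Jac ((archIsotropyProj (L : Type) V.Hm ι₁ V.sylvesterFrame (sylvesterFrame_formCongr V) k : stabilizer U21 x₀) : U21) x₀)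
    (fun k => det_Jac_archIsotropyProj V k)
    (hA_total @G @hG @hGR @η @hη @hηc @hGR₀ @hGR₁ @hGR₂ @hGR₃ @AG hHD hI h₁ h₃ V c hV hc _
      (fun Γ k => toLatticeModelG_kInftyCorr_mem V hV Γ.K k))
    (hB_total @G @hG @hGR @η @hη @hηc @hGR₀ @hGR₁ @hGR₂ @hGR₃ @AG hHD hI h₁ h₃ V c hV hc _
      (fun Γ k => toLatticeModelG_kInftyCorr_mem V hV Γ.K k))

/-- the (34) see-saw record of kit #8 at the TOTAL pins, under the guard, both clauses discharged. -/
def _root_.HodgeCM.Model.SeesawHyp34.ofGuarded (hc : G V c) : SeesawHyp34 (Gen12Pins.Wg @hGR @η @hη @hηc @Gen12Pins.τSyl @Gen12Pins.TSyl @Gen12Pins.hTSyl) (SInstance.SGP @G @hG @hGR @η @hη @hηc @hGR₀ @hGR₁ @hGR₂ @hGR₃ @AG) V c where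
  τ φ₂ φ₃ := tau34 V c.D φ₂ φ₃
  seesaw g t φ₂ φ₃ := seesaw34_total @G @hG @hGR @η @hη @hηc @hGR₀ @hGR₁ @hGR₂ @hGR₃ @AG V c hc g t φ₂ φ₃

/-! ## 3. RECORD 1 and row `gen12` at the total pins -/

/-- kit #10's `hΘ` at the (Θ-sat) pin is definitional for ANY `S` (`ThetaSpaceInput.Θ_eq`). -/
theorem hΘ_total (Γ : Level V) (k : Fin 4) :
    (pinX hHD hI h₁ h₃ (SInstance.SGP @G @hG @hGR @η @hη @hηc @hGR₀ @hGR₁ @hGR₂ @hGR₃ @AG) V c hV).Θ k Γ ≤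
      ⨆ Sit : {Sit : KTypeSituation ((pinX hHD hI h₁ h₃ (SInstance.SGP @G @hG @hGR @η @hη @hηc @hGR₀ @hGR₁ @hGR₂ @hGR₃ @AG) V c hV).P k) ((pinX hHD hI h₁ h₃ (SInstance.SGP @G @hG @hGR @η @hη @hηc @hGR₀ @hGR₁ @hGR₂ @hGR₃ @AG) V c hV).ιinf Γ)
          ((pinX hHD hI h₁ h₃ (SInstance.SGP @G @hG @hGR @η @hη @hηc @hGR₀ @hGR₁ @hGR₂ @hGR₃ @AG) V c hV).Δ Γ) (pinX hHD hI h₁ h₃ (SInstance.SGP @G @hG @hGR @η @hη @hηc @hGR₀ @hGR₁ @hGR₂ @hGR₃ @AG) V c hV).κ₁ (pinX hHD hI h₁ h₃ (SInstance.SGP @G @hG @hGR @η @hη @hηc @hGR₀ @hGR₁ @hGR₂ @hGR₃ @AG) V c hV).τ₁ //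
            Sit.IsSaturated ((pinX hHD hI h₁ h₃ (SInstance.SGP @G @hG @hGR @η @hη @hηc @hGR₀ @hGR₁ @hGR₂ @hGR₃ @AG) V c hV).KΓ Γ) ∧ Sit.IsStrict},
        Sit.1.forms (((pinX hHD hI h₁ h₃ (SInstance.SGP @G @hG @hGR @η @hη @hηc @hGR₀ @hGR₁ @hGR₂ @hGR₃ @AG) V c hV).P k).weightFunctions) :=
  (ThetaSpaceInput.Θ_eq _ k Γ).le

/-- D-1′'s frame junction `hι` at the total S pin, under the guard (sinst-1 `thetaAdelicSideOf_ιinf_apply`). -/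
theorem hι_total (hc : G V c) (u : U21) :
    ((SInstance.SGP @G @hG @hGR @η @hη @hηc @hGR₀ @hGR₁ @hGR₂ @hGR₃ @AG) V c).ιinf u = Adelic.regimeEquiv L V.Hm hV (archSectionU21CM (L : Type) ι₁ V.Hm V.sylvesterFrame (sylvesterFrame_J V) u) :=
  thetaAdelicSideOfP_ιinf_apply V c (G V c) (hG V c) (hGR V c) (hGR₀ V c) (hGR₁ V c) (hGR₂ V c) (hGR₃ V c) (η V c) (hη V c) (hηc V c) (AG V c) hc hV u

/-- **RECORD 1 `Gen12Residual` at the total pins — under the guard, NO other hypothesis.** -/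
def residual_total (hc : G V c) :
    Gen12Residual hHD hI h₁ h₃ h hA (Gen12Pins.Wg @hGR @η @hη @hηc @Gen12Pins.τSyl @Gen12Pins.TSyl @Gen12Pins.hTSyl) (SInstance.SGP @G @hG @hGR @η @hη @hηc @hGR₀ @hGR₁ @hGR₂ @hGR₃ @AG) μ V c hV :=
  Gen12Residual.ofSaturated hHD hI h₁ h₃ h hA (Gen12Pins.Wg @hGR @η @hη @hηc @Gen12Pins.τSyl @Gen12Pins.TSyl @Gen12Pins.hTSyl) (SInstance.SGP @G @hG @hGR @η @hη @hηc @hGR₀ @hGR₁ @hGR₂ @hGR₃ @AG) μ V c hV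
    (fun Γ _ Sit => Sit.IsSaturated ((pinX hHD hI h₁ h₃ (SInstance.SGP @G @hG @hGR @η @hη @hηc @hGR₀ @hGR₁ @hGR₂ @hGR₃ @AG) V c hV).KΓ Γ) ∧ Sit.IsStrict)
    (fun Γ => (pinX hHD hI h₁ h₃ (SInstance.SGP @G @hG @hGR @η @hη @hηc @hGR₀ @hGR₁ @hGR₂ @hGR₃ @AG) V c hV).KΓ Γ)
    (fun _ _ _ hadm => hadm.1)
    (fun Γ k _ => hΘ_total @G @hG @hGR @η @hη @hηc @hGR₀ @hGR₁ @hGR₂ @hGR₃ @AG hHD hI h₁ h₃ V c hV Γ k)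
    (Gen12Junctions.proj_of_pieceUnfolding hHD hI h₁ h₃ h hA (Gen12Pins.Wg @hGR @η @hη @hηc @Gen12Pins.τSyl @Gen12Pins.TSyl @Gen12Pins.hTSyl) (SInstance.SGP @G @hG @hGR @η @hη @hηc @hGR₀ @hGR₁ @hGR₂ @hGR₃ @AG) μ V c hV
      (hι_total @G @hG @hGR @η @hη @hηc @hGR₀ @hGR₁ @hGR₂ @hGR₃ @AG V c hV hc))

/-- read-back: the admissibility of `residual_total` (definitional). -/
theorem residual_total_Adm (hc : G V c) :
    (residual_total @G @hG @hGR @η @hη @hηc @hGR₀ @hGR₁ @hGR₂ @hGR₃ @AG hHD hI h₁ h₃ h hA @μ V c hV hc).Adm =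
      fun Γ _ Sit => Sit.IsSaturated ((pinX hHD hI h₁ h₃ (SInstance.SGP @G @hG @hGR @η @hη @hηc @hGR₀ @hGR₁ @hGR₂ @hGR₃ @AG) V c hV).KΓ Γ) ∧ Sit.IsStrict :=
  rfl

/-- (N1) currency at the total S pin under the guard: `((S V c).P k).w = (A V c k).w` (sinst-1 `thetaAdelicSideOf_P_w`). -/
theorem ST_P_w (hc : G V c) (k : Fin 4) : (((SInstance.SGP @G @hG @hGR @η @hη @hηc @hGR₀ @hGR₁ @hGR₂ @hGR₃ @AG) V c).P k).w = (AG V c hc k).w :=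
  thetaAdelicSideOfP_P_w V c (G V c) (hG V c) (hGR V c) (hGR₀ V c) (hGR₁ V c) (hGR₂ V c) (hGR₃ V c) (η V c) (hη V c) (hηc V c) (AG V c) hc k

end Context

/-- the guard READ OFF E's good-context hypothesis at the pins of record (sinst-1, any core: `pinT = (pinC …).thetaModel …` by `rfl`). -/
theorem planeDefinite_of_goodCtx {L : CMField} {ι₁ : L →+* ℂ} (c : SeesawCtx L)
    (hc : (pinT hHD hI h₁ h₃ h hA (Gen12Pins.Wg @hGR @η @hη @hηc @Gen12Pins.τSyl @Gen12Pins.TSyl @Gen12Pins.hTSyl) (SInstance.SGP @G @hG @hGR @η @hη @hηc @hGR₀ @hGR₁ @hGR₂ @hGR₃ @AG) μ).GoodCtx ι₁ c) :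
    (∀ j, 0 < (ι₁ (dW c.D j)).re) ∨ ∀ j, (ι₁ (dW c.D j)).re < 0 :=
  dW_definite_of_thetaModel_goodCtx ι₁ c (pinC hHD hI h₁ h₃ hA (Gen12Pins.Wg @hGR @η @hη @hηc @Gen12Pins.τSyl @Gen12Pins.TSyl @Gen12Pins.hTSyl) (SInstance.SGP @G @hG @hGR @η @hη @hηc @hGR₀ @hGR₁ @hGR₂ @hGR₃ @AG)) h (d12Of μ) (d34Of μ)
    ((pinT_eq_thetaModel hHD hI h₁ h₃ h hA (Gen12Pins.Wg @hGR @η @hη @hηc @Gen12Pins.τSyl @Gen12Pins.TSyl @Gen12Pins.hTSyl) (SInstance.SGP @G @hG @hGR @η @hη @hηc @hGR₀ @hGR₁ @hGR₂ @hGR₃ @AG) μ) ▸ hc)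

/-- **E's binder `gen12` AT THE TOTAL PINS OF RECORD from the GUARDED literal check (N1)₀,₁** (quantified form): kit #7 `gen12_of_seesaw` with
`R := residual_total` and `H := (SeesawCore.ofGuardedPin …).toHyp …`, the guard and (N1) both read at the good context in hand. -/
theorem gen12_total
    (hGc : ∀ {L : CMField} {ι₁ : L →+* ℂ} (V : HermSpace3 L ι₁) (c : SeesawCtx L),
      (pinT hHD hI h₁ h₃ h hA (Gen12Pins.Wg @hGR @η @hη @hηc @Gen12Pins.τSyl @Gen12Pins.TSyl @Gen12Pins.hTSyl) (SInstance.SGP @G @hG @hGR @η @hη @hηc @hGR₀ @hGR₁ @hGR₂ @hGR₃ @AG) μ).GoodCtx ι₁ c → G V c)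
    (hN1g : ∀ {L : CMField} {ι₁ : L →+* ℂ} (V : HermSpace3 L ι₁) (c : SeesawCtx L)
      (hc : (pinT hHD hI h₁ h₃ h hA (Gen12Pins.Wg @hGR @η @hη @hηc @Gen12Pins.τSyl @Gen12Pins.TSyl @Gen12Pins.hTSyl) (SInstance.SGP @G @hG @hGR @η @hη @hηc @hGR₀ @hGR₁ @hGR₂ @hGR₃ @AG) μ).GoodCtx ι₁ c), ∀ k : Fin 4, k = 0 ∨ k = 1 → (AG V c (hGc V c hc) k).w = ⇑(archWeight L (μ c k)))
    {L : CMField} {ι₁ : L →+* ℂ} (V : HermSpace3 L ι₁) (c : SeesawCtx L)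
    (hc : (pinT hHD hI h₁ h₃ h hA (Gen12Pins.Wg @hGR @η @hη @hηc @Gen12Pins.τSyl @Gen12Pins.TSyl @Gen12Pins.hTSyl) (SInstance.SGP @G @hG @hGR @η @hη @hηc @hGR₀ @hGR₁ @hGR₂ @hGR₃ @AG) μ).GoodCtx ι₁ c) (hK : Module.finrank ℚ c.K = 6) :
    Nonempty ((pinT hHD hI h₁ h₃ h hA (Gen12Pins.Wg @hGR @η @hη @hηc @Gen12Pins.τSyl @Gen12Pins.TSyl @Gen12Pins.hTSyl) (SInstance.SGP @G @hG @hGR @η @hη @hηc @hGR₀ @hGR₁ @hGR₂ @hGR₃ @AG) μ).Gen12FunBridge V c) :=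
  gen12_of_seesaw hHD hI h₁ h₃ h hA (Gen12Pins.Wg @hGR @η @hη @hηc @Gen12Pins.τSyl @Gen12Pins.TSyl @Gen12Pins.hTSyl) (SInstance.SGP @G @hG @hGR @η @hη @hηc @hGR₀ @hGR₁ @hGR₂ @hGR₃ @AG) μ
    (fun V c hV hc _ => residual_total @G @hG @hGR @η @hη @hηc @hGR₀ @hGR₁ @hGR₂ @hGR₃ @AG hHD hI h₁ h₃ h hA @μ V c hV
      (hGc V c hc))
    (fun V c hV hc _ =>
      (SeesawCore.ofGuardedPin @G @hG @hGR @η @hη @hηc @hGR₀ @hGR₁ @hGR₂ @hGR₃ @AG hHD hI h₁ h₃ V c hV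
        (hGc V c hc)).toHyp
        ((ST_P_w @G @hG @hGR @η @hη @hηc @hGR₀ @hGR₁ @hGR₂ @hGR₃ @AG V c
            (hGc V c hc) 0).trans
          (hN1g V c hc 0 (Or.inl rfl)))
        ((ST_P_w @G @hG @hGR @η @hη @hηc @hGR₀ @hGR₁ @hGR₂ @hGR₃ @AG V c
            (hGc V c hc) 1).trans
          (hN1g V c hc 1 (Or.inr rfl))))
    V c hc hK

/-- **Row `gen12` PER CONTEXT under the guard** (no family-level guard hypothesis): at a good sextic context `(V, c)` with `hg : G V c` and the
(N1)₀,₁ weights read at THAT context, E's `Gen12FunBridge V c` is inhabited — `Gen12Junctions.nonempty_gen12FunBridge` of the junctions of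
`residual_total hg` and `(SeesawCore.ofGuardedPin hg).toHyp`.  This is the shape a POINTWISE-guarded E child (`S := SROG`, bit `orientBitι L ι₁`)
consumes on its honest branch; the off-guard branch is sanity-1's. -/
theorem gen12_totalAt {L : CMField} {ι₁ : L →+* ℂ} (V : HermSpace3 L ι₁) (c : SeesawCtx L) (hg : G V c)
    (hc : (pinT hHD hI h₁ h₃ h hA (Gen12Pins.Wg @hGR @η @hη @hηc @Gen12Pins.τSyl @Gen12Pins.TSyl @Gen12Pins.hTSyl) (SInstance.SGP @G @hG @hGR @η @hη @hηc @hGR₀ @hGR₁ @hGR₂ @hGR₃ @AG) μ).GoodCtx ι₁ c) (hK : Module.finrank ℚ c.K = 6)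
    (hN1 : ∀ k : Fin 4, k = 0 ∨ k = 1 → (AG V c hg k).w = ⇑(archWeight L (μ c k))) :
    Nonempty ((pinT hHD hI h₁ h₃ h hA (Gen12Pins.Wg @hGR @η @hη @hηc @Gen12Pins.τSyl @Gen12Pins.TSyl @Gen12Pins.hTSyl) (SInstance.SGP @G @hG @hGR @η @hη @hηc @hGR₀ @hGR₁ @hGR₂ @hGR₃ @AG) μ).Gen12FunBridge V c) :=
  ((residual_total @G @hG @hGR @η @hη @hηc @hGR₀ @hGR₁ @hGR₂ @hGR₃ @AG hHD hI h₁ h₃ h hA @μ V c (isAnisotropic_of_goodCtx V hc hK) hg).junctions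
    ((SeesawCore.ofGuardedPin @G @hG @hGR @η @hη @hηc @hGR₀ @hGR₁ @hGR₂ @hGR₃ @AG hHD hI h₁ h₃ V c (isAnisotropic_of_goodCtx V hc hK) hg).toHyp
      ((ST_P_w @G @hG @hGR @η @hη @hηc @hGR₀ @hGR₁ @hGR₂ @hGR₃ @AG V c hg 0).trans (hN1 0 (Or.inl rfl)))
      ((ST_P_w @G @hG @hGR @η @hη @hηc @hGR₀ @hGR₁ @hGR₂ @hGR₃ @AG V c hg 1).trans (hN1 1 (Or.inr rfl)))) hc).nonempty_gen12FunBridge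

/-- **E's binder `gen12` IN E's OWN TEXT at the total pins of record.** -/
theorem gen12_totalE
    (hGc : ∀ {L : CMField} {ι₁ : L →+* ℂ} (V : HermSpace3 L ι₁) (c : SeesawCtx L),
      (pinT hHD hI h₁ h₃ h hA (Gen12Pins.Wg @hGR @η @hη @hηc @Gen12Pins.τSyl @Gen12Pins.TSyl @Gen12Pins.hTSyl) (SInstance.SGP @G @hG @hGR @η @hη @hηc @hGR₀ @hGR₁ @hGR₂ @hGR₃ @AG) μ).GoodCtx ι₁ c → G V c)
    (hN1g : ∀ {L : CMField} {ι₁ : L →+* ℂ} (V : HermSpace3 L ι₁) (c : SeesawCtx L)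
      (hc : (pinT hHD hI h₁ h₃ h hA (Gen12Pins.Wg @hGR @η @hη @hηc @Gen12Pins.τSyl @Gen12Pins.TSyl @Gen12Pins.hTSyl) (SInstance.SGP @G @hG @hGR @η @hη @hηc @hGR₀ @hGR₁ @hGR₂ @hGR₃ @AG) μ).GoodCtx ι₁ c), ∀ k : Fin 4, k = 0 ∨ k = 1 → (AG V c (hGc V c hc) k).w = ⇑(archWeight L (μ c k))) :
    ∀ {L : CMField} {ι₁ : L →+* ℂ} (V : HermSpace3 L ι₁) (c : SeesawCtx L),
      (thetaModelOf hHD hI h₁ h₃ h (embOf hHD hI h₁ h₃) (coverOf hHD hI h₁ h₃ hA) (wmOfInput (Gen12Pins.Wg @hGR @η @hη @hηc @Gen12Pins.τSyl @Gen12Pins.TSyl @Gen12Pins.hTSyl))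
        (thetaOf _ (thetaClassInputOf _ (fun V c => thetaSpaceInputOf hHD hI h₁ h₃ (SInstance.SGP @G @hG @hGR @η @hη @hηc @hGR₀ @hGR₁ @hGR₂ @hGR₃ @AG) V c))) (d12Of μ) (d34Of μ)).GoodCtx ι₁ c →
      Module.finrank ℚ c.K = 6 →
      Nonempty ((thetaModelOf hHD hI h₁ h₃ h (embOf hHD hI h₁ h₃) (coverOf hHD hI h₁ h₃ hA) (wmOfInput (Gen12Pins.Wg @hGR @η @hη @hηc @Gen12Pins.τSyl @Gen12Pins.TSyl @Gen12Pins.hTSyl))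
        (thetaOf _ (thetaClassInputOf _ (fun V c => thetaSpaceInputOf hHD hI h₁ h₃ (SInstance.SGP @G @hG @hGR @η @hη @hηc @hGR₀ @hGR₁ @hGR₂ @hGR₃ @AG) V c))) (d12Of μ) (d34Of μ)).Gen12FunBridge V c) :=
  fun V c hc hK => gen12_total @G @hG @hGR @η @hη @hηc @hGR₀ @hGR₁ @hGR₂ @hGR₃ @AG hHD hI h₁ h₃ h hA @μ hGc hN1g V c hc hK

/-! ## 4. Row `real34` at the total pins -/

section Context34

variable {L : CMField} {ι₁ : L →+* ℂ} (V : HermSpace3 L ι₁) (c : SeesawCtx L) (hV : IsAnisotropic L V.Hm)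

/-- `hGfin` at the total S pin under the guard (sinst-1's (L3b) read-back at `kf⁻¹`). -/
theorem hGfin_total (hc : G V c) (kf : V.adelicFin) : finTranslate V hV kf ∈ ((SInstance.SGP @G @hG @hGR @η @hη @hηc @hGR₀ @hGR₁ @hGR₂ @hGR₃ @AG) V c).Gfin :=
  regimeEquiv_prodSymm_one_mem_thetaAdelicSideOfP_Gfin V c (G V c) (hG V c) (hGR V c) (hGR₀ V c) (hGR₁ V c) (hGR₂ V c) (hGR₃ V c) (η V c) (hη V c)
    (hηc V c) (AG V c) hc hV kf⁻¹

/-- **The RESIDUAL junctions of row `real34` at the total pins, per GOOD context** (the guard `hdef` is part of the context): (L3) `hcorr`,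
(K34) `gen_mem`, C3₂,₃ — a HYPOTHESIS record, nothing asserted. -/
structure Real34GuardedResidual (hc : G V c) where
  /-- (L3) level correctors inside the saturation subgroup -/
  hcorr : ∀ (Γ : Level V), ∀ δ ∈ levelImage hHD hI h₁ h₃ Γ hV,
    ∃ x : (V.latticeModel printFact_unitaryCompact_holds).G, x ∈ satLevelRegimeOf V hV Γ.K ∧
      ((SInstance.SGP @G @hG @hGR @η @hη @hηc @hGR₀ @hGR₁ @hGR₂ @hGR₃ @AG) V c).ιinf δ * x ∈ (V.latticeModel printFact_unitaryCompact_holds).Γ ∧ ∀ y : U21, Commute x (((SInstance.SGP @G @hG @hGR @η @hη @hηc @hGR₀ @hGR₁ @hGR₂ @hGR₃ @AG) V c).ιinf y)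
  /-- (K34) at the wset of the pinned record built on `hGfin_total` and `hcorr` -/
  gen_mem : ∀ (χ : ((pinT hHD hI h₁ h₃ h hA (Gen12Pins.Wg @hGR @η @hη @hηc @Gen12Pins.τSyl @Gen12Pins.TSyl @Gen12Pins.hTSyl) (SInstance.SGP @G @hG @hGR @η @hη @hηc @hGR₀ @hGR₁ @hGR₂ @hGR₃ @AG) μ).t34 V c).X) (Φ : (pinT hHD hI h₁ h₃ h hA (Gen12Pins.Wg @hGR @η @hη @hηc @Gen12Pins.τSyl @Gen12Pins.TSyl @Gen12Pins.hTSyl) (SInstance.SGP @G @hG @hGR @η @hη @hηc @hGR₀ @hGR₁ @hGR₂ @hGR₃ @AG) μ).SK V c),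
    ((pinT hHD hI h₁ h₃ h hA (Gen12Pins.Wg @hGR @η @hη @hηc @Gen12Pins.τSyl @Gen12Pins.TSyl @Gen12Pins.hTSyl) (SInstance.SGP @G @hG @hGR @η @hη @hηc @hGR₀ @hGR₁ @hGR₂ @hGR₃ @AG) μ).t34 V c).ϑ χ Φ ∈
      (Submodule.span ℂ (Real34Loc.ofThetaSat hHD hI h₁ h₃ h hA (Gen12Pins.Wg @hGR @η @hη @hηc @Gen12Pins.τSyl @Gen12Pins.TSyl @Gen12Pins.hTSyl) (SInstance.SGP @G @hG @hGR @η @hη @hηc @hGR₀ @hGR₁ @hGR₂ @hGR₃ @AG) μ V c hV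
        (hGfin_total @G @hG @hGR @η @hη @hηc @hGR₀ @hGR₁ @hGR₂ @hGR₃ @AG V c hV hc) hcorr).wset).topologicalClosure
  /-- C3 for type `2` -/
  hU₂ : ∀ Γ : Level V, (pinT hHD hI h₁ h₃ h hA (Gen12Pins.Wg @hGR @η @hη @hηc @Gen12Pins.τSyl @Gen12Pins.TSyl @Gen12Pins.hTSyl) (SInstance.SGP @G @hG @hGR @η @hη @hηc @hGR₀ @hGR₁ @hGR₂ @hGR₃ @AG) μ).Theta V c 2 Γ ⊆ (picardCMUniverse hHD hI h₁ h₃).Uiso Γ c.K (c.Ψ 2) c.σ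
  /-- C3 for type `3` -/
  hU₃ : ∀ Γ : Level V, (pinT hHD hI h₁ h₃ h hA (Gen12Pins.Wg @hGR @η @hη @hηc @Gen12Pins.τSyl @Gen12Pins.TSyl @Gen12Pins.hTSyl) (SInstance.SGP @G @hG @hGR @η @hη @hηc @hGR₀ @hGR₁ @hGR₂ @hGR₃ @AG) μ).Theta V c 3 Γ ⊆ (picardCMUniverse hHD hI h₁ h₃).Uiso Γ c.K (c.Ψ 3) c.σ

/-- the residual record completes g8's `Real34PinJunctions` at the total pins (`hGfin := hGfin_total`, `hι := hι_total`). -/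
theorem Real34GuardedResidual.toJunctions {hHD hI h₁ h₃ h hA μ} {V : HermSpace3 L ι₁} {c : SeesawCtx L} {hV : IsAnisotropic L V.Hm}
    {hc : G V c}
    (R : Real34GuardedResidual @G @hG @hGR @η @hη @hηc @hGR₀ @hGR₁ @hGR₂ @hGR₃ @AG hHD hI h₁ h₃ h hA @μ V c hV hc) :
    Real34PinJunctions hHD hI h₁ h₃ h hA (Gen12Pins.Wg @hGR @η @hη @hηc @Gen12Pins.τSyl @Gen12Pins.TSyl @Gen12Pins.hTSyl) (SInstance.SGP @G @hG @hGR @η @hη @hηc @hGR₀ @hGR₁ @hGR₂ @hGR₃ @AG) μ V c hV :=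
  ⟨hGfin_total @G @hG @hGR @η @hη @hηc @hGR₀ @hGR₁ @hGR₂ @hGR₃ @AG V c hV hc, R.hcorr, R.gen_mem,
    hι_total @G @hG @hGR @η @hη @hηc @hGR₀ @hGR₁ @hGR₂ @hGR₃ @AG V c hV hc, R.hU₂, R.hU₃⟩

end Context34

/-- **E's binder `real34` AT THE TOTAL PINS** (quantified form) from the residual record at each good context. -/
theorem real34_total (hGc : ∀ {L : CMField} {ι₁ : L →+* ℂ} (V : HermSpace3 L ι₁) (c : SeesawCtx L),
      (pinT hHD hI h₁ h₃ h hA (Gen12Pins.Wg @hGR @η @hη @hηc @Gen12Pins.τSyl @Gen12Pins.TSyl @Gen12Pins.hTSyl) (SInstance.SGP @G @hG @hGR @η @hη @hηc @hGR₀ @hGR₁ @hGR₂ @hGR₃ @AG) μ).GoodCtx ι₁ c → G V c)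
    (hpc : (picardCMUniverse hHD hI h₁ h₃).Fact_pull_comp)
    (hcup : (picardCMUniverse hHD hI h₁ h₃).Fact_pull_cup) (hph : (picardCMUniverse hHD hI h₁ h₃).Fact_pull_hodge)
    (R : ∀ {L : CMField} {ι₁ : L →+* ℂ} (V : HermSpace3 L ι₁) (c : SeesawCtx L) (hV : IsAnisotropic L V.Hm)
      (hc : (pinT hHD hI h₁ h₃ h hA (Gen12Pins.Wg @hGR @η @hη @hηc @Gen12Pins.τSyl @Gen12Pins.TSyl @Gen12Pins.hTSyl) (SInstance.SGP @G @hG @hGR @η @hη @hηc @hGR₀ @hGR₁ @hGR₂ @hGR₃ @AG) μ).GoodCtx ι₁ c), Module.finrank ℚ c.K = 6 →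
        Real34GuardedResidual @G @hG @hGR @η @hη @hηc @hGR₀ @hGR₁ @hGR₂ @hGR₃ @AG hHD hI h₁ h₃ h hA @μ V c hV
          (hGc V c hc))
    {L : CMField} {ι₁ : L →+* ℂ} (V : HermSpace3 L ι₁) (c : SeesawCtx L)
    (hc : (pinT hHD hI h₁ h₃ h hA (Gen12Pins.Wg @hGR @η @hη @hηc @Gen12Pins.τSyl @Gen12Pins.TSyl @Gen12Pins.hTSyl) (SInstance.SGP @G @hG @hGR @η @hη @hηc @hGR₀ @hGR₁ @hGR₂ @hGR₃ @AG) μ).GoodCtx ι₁ c) (hK : Module.finrank ℚ c.K = 6) :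
    Nonempty ((pinT hHD hI h₁ h₃ h hA (Gen12Pins.Wg @hGR @η @hη @hηc @Gen12Pins.τSyl @Gen12Pins.TSyl @Gen12Pins.hTSyl) (SInstance.SGP @G @hG @hGR @η @hη @hηc @hGR₀ @hGR₁ @hGR₂ @hGR₃ @AG) μ).Real34FunBridge V c) :=
  real34_of_thetaSat hHD hI h₁ h₃ h hA (Gen12Pins.Wg @hGR @η @hη @hηc @Gen12Pins.τSyl @Gen12Pins.TSyl @Gen12Pins.hTSyl) (SInstance.SGP @G @hG @hGR @η @hη @hηc @hGR₀ @hGR₁ @hGR₂ @hGR₃ @AG) μ hpc hcup hph (fun V c hV hc hK => (R V c hV hc hK).toJunctions) V c hc hK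


-- port_pkg: scope closed for this part
end Gen12PinsP
end HodgeCM.Model
end
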